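import Mathlib
import Literature.AlgebraicGeometry.Resolution.WeightedResolutionDatum
import Summits.ResolutionOfSingularities.ResolutionOfSingularities.Theorems.WeightedInvariantHypersurfaceLocalGameEFT4S
import Summits.ResolutionOfSingularities.ResolutionOfSingularities.Theorems.WeightedInvariantHypersurfaceLocalGameEFT4Seams
import Summits.ResolutionOfSingularities.ResolutionOfSingularities.Theorems.WeightedInvariantEssSmoothLocalHomOrder

/-!
# Door line `local-engine` (crux `HypersurfaceCentreConstruction`, stmt-ResolutionOfSingularities-19897):
# the by-name seam `eft3_of_eft4S : LocalWeightedDropEFT4S p → LocalWeightedDropEFT3 p`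

res-L1-w43-plan-1 ORDER (o22) (HOME/STATUS 2026-08-27T06:22:12Z); RULING (o22) 06:29:38Z recorded the seam as «not
derivable as typed» ((open″) presents `J` only where `F_𝔮 ∈ 𝔪_𝔮²`, (open) asks it wherever `F ∈ 𝔮` with the same
`ι`-value); res-type-070 FINDING 06:36:18Z / res-type-061 06:34:02Z–06:37:51Z: it IS derivable by WITNESS MODIFICATION.
This file proves it, sorry-free and def-free.

IDEA.  Keep `ι`; replace `J` by `J♯(R, g, m) := ⊤` when `R` is local and `g ∉ 𝔪_R²`, `:= J(R, g, m)` otherwise.  At a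
prime `𝔮 ∈ D(h)` of the model where `F` is a REGULAR parameter, (open″)'s stratum iff says NOT all `U_i` lie in `𝔮`, so
some `U_i` is a unit in `A_𝔮` and (weights positive) the extended weighted monomial ideals are the unit ideal `= J♯`;
where `F_𝔮 ∈ 𝔪_𝔮²`, `J♯ = J` and (open″) presents it.  `J♯` keeps `JIsoInvariant`, `JUnitInvariant`, the game clause
((loc)/(pres) live at germs in `𝔪²` by (adm)) verbatim; the ONE clause with content is (c11) `IotaJEssSmoothCompatible`,
which needs «an essentially smooth local homomorphism of regular local rings REFLECTS `𝔪²`» — the library theorem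
`mem_pow_maximalIdeal_iff_of_formallySmooth_essFiniteType` (module `…WeightedInvariantEssSmoothLocalHomOrder`: flatness
of formally-smooth e.f.t. algebras + regular closed fibre + the tree's `OrderFlatLocalHom`).  The finite-type model of an
e.f.t. local position is res-type-061's `exists_finiteType_model` (p505133).

CONSEQUENCE.  The ladder is literally linear: `EFT4S ⇒ EFT3 ⇒ EFT′` (`eft3_of_eft4S`, `eft_of_eft3`); every
EFT3-level result — including a refutation THROUGH (open) — transfers to the registered key `LocalWeightedDropEFT4S`.
[OURS · L1 W4.3 · res-type-070; candidates only, nothing about Hironaka's problem is asserted; AI work, weaker than expert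
review.]
-/

set_option linter.dupNamespace false

noncomputable section

open IsLocalRing Literature.AlgebraicGeometry.Resolution

namespace Summit.ResolutionOfSingularities.ResolutionOfSingularities.Cruxes.HypersurfaceCentreConstruction.LocalEngine

/-! ## §1. Transport across a model isomorphism -/

section Transport

variable {T S : Type} [CommRing T] [CommRing S]

/-- [folklore] `x ≠ 0` if `e x ≠ 0`. -/
theorem ne_zero_of_ringEquiv_apply_ne_zero (e : T ≃+* S) {x : T} (hx : e x ≠ 0) : x ≠ 0 := by
  rintro rfl
  exact hx (map_zero e)

/-- [folklore] Membership in `𝔪²` transports along an isomorphism of local rings. -/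
theorem mem_sq_maximalIdeal_of_ringEquiv_apply [IsLocalRing T] [IsLocalRing S] (e : T ≃+* S) {x : T}
    (hx : e x ∈ (maximalIdeal S) ^ 2) : x ∈ (maximalIdeal T) ^ 2 := by
  have h1 : e.symm (e x) ∈ ((maximalIdeal S) ^ 2).map (e.symm : S →+* T) := Ideal.mem_map_of_mem _ hx
  rw [Ideal.map_pow, RingEquiv.symm_apply_apply] at h1
  have h2 : (maximalIdeal S).map (e.symm : S →+* T) = maximalIdeal T := IsLocalRing.map_ringEquiv_maximalIdeal e.symm
  rwa [h2] at h1

end Transport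

/-! ## §2. A unit among the parameters makes every weighted monomial ideal the unit ideal -/

section Monomial

variable {A : Type} [CommRing A]

/-- [folklore] `u_i ^ m` is a monomial of weighted degree `≥ m` as soon as `w_i > 0`. -/
theorem pow_mem_weightedMonomialIdeal {N : ℕ} (U : Fin N → A) (W : Fin N → ℕ) (i : Fin N) (hWi : 0 < W i) (m : ℕ) :
    U i ^ m ∈ weightedMonomialIdeal U W m := by
  classical
  refine Ideal.subset_span ⟨Pi.single i m, ?_, ?_⟩
  · calc m ≤ W i * m := Nat.le_mul_of_pos_left m hWi
      _ = ∑ j, W j * (Pi.single i m : Fin N → ℕ) j := by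
          rw [Finset.sum_eq_single i]
          · simp
          · intro j _ hj; simp [Pi.single_eq_of_ne hj]
          · intro h; exact absurd (Finset.mem_univ i) h
  · rw [Finset.prod_eq_single i]
    · simp
    · intro j _ hj; simp [Pi.single_eq_of_ne hj]
    · intro h; exact absurd (Finset.mem_univ i) h

/-- [folklore] If some parameter of positive weight becomes a unit in `B`, every extended weighted monomial ideal is `⊤`. -/
theorem map_weightedMonomialIdeal_eq_top {B : Type} [CommRing B] (φ : A →+* B) {N : ℕ} (U : Fin N → A) (W : Fin N → ℕ)
    (i : Fin N) (hWi : 0 < W i) (hu : IsUnit (φ (U i))) (m : ℕ) :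
    (weightedMonomialIdeal U W m).map φ = ⊤ :=
  Ideal.eq_top_of_isUnit_mem _ (Ideal.mem_map_of_mem φ (pow_mem_weightedMonomialIdeal U W i hWi m))
    (by rw [map_pow]; exact hu.pow m)

end Monomial

/-! ## §3. The modified centre filtration `J♯` and the clause transfers -/

section Sharp

variable (J J' : (R : Type) → [CommRing R] → R → ℕ → Ideal R)
  (hA : ∀ (R : Type) [CommRing R] [IsLocalRing R] (g : R) (m : ℕ), g ∉ (maximalIdeal R) ^ 2 → J' R g m = ⊤)
  (hB : ∀ (R : Type) [CommRing R] [IsLocalRing R] (g : R) (m : ℕ), g ∈ (maximalIdeal R) ^ 2 → J' R g m = J R g m)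
  (hC : ∀ (R : Type) [CommRing R] (g : R) (m : ℕ), ¬ IsLocalRing R → J' R g m = J R g m)

include hA hB hC in
/-- `J♯` is iso-invariant if `J` is. -/
theorem jIsoInvariant_sharp (hJ : JIsoInvariant J) : JIsoInvariant J' := by
  intro R T _ _ e g m
  by_cases hR : IsLocalRing R
  · haveI := hR
    haveI : IsLocalRing T := e.isLocalRing
    by_cases hg : g ∈ (maximalIdeal R) ^ 2
    · have heg : e g ∈ (maximalIdeal T) ^ 2 :=
        mem_sq_maximalIdeal_of_ringEquiv_apply e.symm (by rw [RingEquiv.symm_apply_apply]; exact hg)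
      rw [hB R g m hg, hB T (e g) m heg]
      exact hJ R T e g m
    · have heg : e g ∉ (maximalIdeal T) ^ 2 := fun h => hg (mem_sq_maximalIdeal_of_ringEquiv_apply e h)
      rw [hA R g m hg, hA T (e g) m heg, Ideal.map_top]
  · have hT : ¬ IsLocalRing T := fun h => hR (by haveI := h; exact e.symm.isLocalRing)
    rw [hC R g m hR, hC T (e g) m hT]
    exact hJ R T e g m

include hA hB hC in
/-- `J♯` is unit-invariant if `J` is. -/
theorem jUnitInvariant_sharp (hJ : JUnitInvariant J) : JUnitInvariant J' := by
  intro R _ v g m hv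
  by_cases hR : IsLocalRing R
  · haveI := hR
    by_cases hg : g ∈ (maximalIdeal R) ^ 2
    · have hvg : v * g ∈ (maximalIdeal R) ^ 2 := (Ideal.unit_mul_mem_iff_mem _ hv).mpr hg
      rw [hB R g m hg, hB R (v * g) m hvg]
      exact hJ R v g m hv
    · have hvg : v * g ∉ (maximalIdeal R) ^ 2 := fun h => hg ((Ideal.unit_mul_mem_iff_mem _ hv).mp h)
      rw [hA R g m hg, hA R (v * g) m hvg]
  · rw [hC R g m hR, hC R (v * g) m hR]
    exact hJ R v g m hv

include hA hB in
/-- (c11) for `(ι, J♯)`: the `J`-half transfers because an essentially smooth local homomorphism of regular local rings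
preserves AND REFLECTS `𝔪²` (`mem_pow_maximalIdeal_iff_of_formallySmooth_essFiniteType`). -/
theorem iotaJEssSmoothCompatible_sharp (ι : (R : Type) → [CommRing R] → R → Ordinal.{0})
    (h : IotaJEssSmoothCompatible ι J) : IotaJEssSmoothCompatible ι J' := by
  intro S S' _ _ _ _ _ _ _ _ f
  obtain ⟨hι, hJ⟩ := h S S' f
  refine ⟨hι, fun m => ?_⟩
  by_cases hf : f ∈ (maximalIdeal S) ^ 2
  · have hf' : algebraMap S S' f ∈ (maximalIdeal S') ^ 2 :=
      (mem_pow_maximalIdeal_iff_of_formallySmooth_essFiniteType 2 f).mp hf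
    rw [hB S f m hf, hB S' _ m hf']
    exact hJ m
  · have hf' : algebraMap S S' f ∉ (maximalIdeal S') ^ 2 :=
      fun h => hf ((mem_pow_maximalIdeal_iff_of_formallySmooth_essFiniteType 2 f).mpr h)
    rw [hA S f m hf, hA S' _ m hf', Ideal.map_top]

include hB in
/-- The game clause (c9′) transfers from `(ι, J)` to `(ι, J♯)`: positions and the primes over the centre are germs in `𝔪²`
((adm)), where `J♯ = J`. -/
theorem canonicalGameClause_sharp (p : ℕ) (ι : (R : Type) → [CommRing R] → R → Ordinal.{0})
    (h : CanonicalGameClause p ι J) : CanonicalGameClause p ι J' := by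
  intro k₀ _ _ _ S _ _ _ _ f hf0 hf2
  obtain ⟨P, hP, hreg, hfP, hstrat, hloc, n, u, w, hspan, hrk, hpos, hctr, hpres, hadm, hsucc⟩ :=
    h k₀ S f hf0 hf2
  haveI := hP
  refine ⟨P, hP, hreg, hfP, hstrat, ?_, n, u, w, hspan, hrk, hpos, hctr, ?_, hadm, hsucc⟩
  · intro 𝔭 _ hf𝔭 hP𝔭 m
    rw [hB S f m hf2, hB (Localization.AtPrime 𝔭) _ m (hadm 𝔭 hP𝔭)]
    exact hloc 𝔭 hf𝔭 hP𝔭 m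
  · intro m
    rw [hB S f m hf2]
    exact hpres m

include hA hB in
/-- **(open″) for `(ι, J)` ⇒ (open) for `(ι, J♯)`** ((c6) across the model isomorphism): at the finite-type model
`(A, 𝔪, e, F)` of a position (p505133 `exists_finiteType_model`), on (open″)'s basic open `D(h)`: at a prime `𝔮 ∋ F` with
`F_𝔮 ∈ 𝔪_𝔮²` and the position's `ι`-value the stratum iff gives `U ⊆ 𝔮` and the presentation of `J = J♯`; at a prime where
`F` is a regular parameter it gives a unit `U_i` in `A_𝔮`, so both sides are `⊤`. -/
theorem jOpenPresentation_sharp_of_forallSing (p : ℕ) (ι : (R : Type) → [CommRing R] → R → Ordinal.{0})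
    (hc6 : IotaIsoInvariant ι) (h : JOpenPresentationForallSing p ι J) : JOpenPresentation p ι J' := by
  classical
  intro k₀ _ _ _ S _ _ _ _ f hf0 hf2
  -- the finite-type model of the position
  obtain ⟨A, hAfg, hfA, hloc⟩ := exists_finiteType_model k₀ S f
  haveI hFT : Algebra.FiniteType k₀ A := (Subalgebra.fg_iff_finiteType A).mp hAfg
  let 𝔪 : Ideal A := (maximalIdeal S).comap (algebraMap A S)
  haveI h𝔪 : 𝔪.IsPrime := Ideal.IsPrime.comap _
  haveI : IsLocalization.AtPrime S 𝔪 := hloc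
  let e : Localization.AtPrime 𝔪 ≃+* S := (IsLocalization.algEquiv 𝔪.primeCompl (Localization.AtPrime 𝔪) S).toRingEquiv
  let F : A := ⟨f, hfA⟩
  have heF : e (algebraMap A (Localization.AtPrime 𝔪) F) = f := by
    change (IsLocalization.algEquiv 𝔪.primeCompl (Localization.AtPrime 𝔪) S) (algebraMap A _ F) = f
    rw [AlgEquiv.commutes]
    rfl
  have hreg : IsRegularLocalRing (Localization.AtPrime 𝔪) := IsRegularLocalRing.of_ringEquiv e.symm
  have hF0 : algebraMap A (Localization.AtPrime 𝔪) F ≠ 0 :=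
    ne_zero_of_ringEquiv_apply_ne_zero e (by rw [heF]; exact hf0)
  have hF2 : algebraMap A (Localization.AtPrime 𝔪) F ∈ (maximalIdeal (Localization.AtPrime 𝔪)) ^ 2 :=
    mem_sq_maximalIdeal_of_ringEquiv_apply e (by rw [heF]; exact hf2)
  have hιe : ι S f = ι (Localization.AtPrime 𝔪) (algebraMap A (Localization.AtPrime 𝔪) F) := by
    rw [← heF]
    exact hc6 _ _ e _
  obtain ⟨hh, hhm, N, U, W, hW, -, hall⟩ := h k₀ A 𝔪 F hreg hF0 hF2
  refine ⟨A, inferInstance, inferInstance, hFT, 𝔪, h𝔪, e, F, heF, hh, hhm, N, U, W, ?_⟩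
  intro 𝔮 _ hq _ hιq m
  obtain ⟨hiff, hpres⟩ := hall 𝔮 hq
  by_cases hU : ∀ i, U i ∈ 𝔮
  · -- singular stratum point: `J♯ = J` is presented by (open″)
    rw [hB (Localization.AtPrime 𝔮) _ m (hiff.mp hU).1]
    exact hpres hU m
  · -- some `U i ∉ 𝔮`: the extended monomial ideals are `⊤`, and so is `J♯` (else the stratum iff would force `U ⊆ 𝔮`)
    obtain ⟨i, hi⟩ := not_forall.mp hU
    rw [map_weightedMonomialIdeal_eq_top (algebraMap A (Localization.AtPrime 𝔮)) U W i (hW i)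
      (IsLocalization.map_units (Localization.AtPrime 𝔮) (⟨U i, hi⟩ : 𝔮.primeCompl)) m]
    -- the membership proposition is taken from (open″)'s iff itself (no restatement)
    have aux : ∀ {Pm : Prop}, (Pm ∧ ι (Localization.AtPrime 𝔮) (algebraMap A (Localization.AtPrime 𝔮) F) =
          ι (Localization.AtPrime 𝔪) (algebraMap A (Localization.AtPrime 𝔪) F) → ∀ i, U i ∈ 𝔮) →
        (¬ Pm → J' (Localization.AtPrime 𝔮) (algebraMap A (Localization.AtPrime 𝔮) F) m = ⊤) →
        J' (Localization.AtPrime 𝔮) (algebraMap A (Localization.AtPrime 𝔮) F) m = ⊤ := by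
      intro Pm h1 h2
      by_cases hp : Pm
      · exact absurd (h1 ⟨hp, hιq.trans hιe⟩) hU
      · exact h2 hp
    exact aux hiff.mpr (fun hFq => hA (Localization.AtPrime 𝔮) _ m hFq)

end Sharp

/-! ## §4. The by-name seam -/

section Seam

open Classical in
/-- **SEAM H2a⁗-S ⇒ H2a‴ BY NAME: `LocalWeightedDropEFT4S p → LocalWeightedDropEFT3 p`.**  Witness modification
`(ι, J) ↦ (ι, J♯)` with `J♯(R, g, m) = ⊤` at local germs `g ∉ 𝔪_R²` and `= J(R, g, m)` otherwise; clause transfers §3;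
the `ι`-clauses (c6)(c7)(c8)(c10)(c12a) are untouched.  Consequence: the ladder `EFT4S ⇒ EFT3 ⇒ EFT′` is linear by name
(`eft_of_eft3`), so every EFT3-level result transfers to the registered key.  OURS; a theorem about the typed candidates. -/
theorem eft3_of_eft4S (p : ℕ) : LocalWeightedDropEFT4S p → LocalWeightedDropEFT3 p := by
  rintro ⟨ι, J, hc6, hc7, hc8, hc10, hJiso, hc11, hgame, hopen, huι, huJ⟩
  let J' : (R : Type) → [CommRing R] → R → ℕ → Ideal R := fun R _ g m =>
    if (∃ _ : IsLocalRing R, g ∉ (maximalIdeal R) ^ 2) then ⊤ else J R g m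
  have hA : ∀ (R : Type) [CommRing R] [IsLocalRing R] (g : R) (m : ℕ), g ∉ (maximalIdeal R) ^ 2 → J' R g m = ⊤ := by
    intro R _ hR g m hg
    exact if_pos ⟨hR, hg⟩
  have hB : ∀ (R : Type) [CommRing R] [IsLocalRing R] (g : R) (m : ℕ), g ∈ (maximalIdeal R) ^ 2 → J' R g m = J R g m := by
    intro R _ hR g m hg
    exact if_neg fun ⟨_, h⟩ => h hg
  have hC : ∀ (R : Type) [CommRing R] (g : R) (m : ℕ), ¬ IsLocalRing R → J' R g m = J R g m := by
    intro R _ g m hR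
    exact if_neg fun ⟨h, _⟩ => hR h
  exact ⟨ι, J', hc6, hc7, hc8, hc10, jIsoInvariant_sharp J J' hA hB hC hJiso,
    iotaJEssSmoothCompatible_sharp J J' hA hB ι hc11, canonicalGameClause_sharp J J' hB p ι hgame,
    jOpenPresentation_sharp_of_forallSing J J' hA hB p ι hc6 hopen, huι, jUnitInvariant_sharp J J' hA hB hC huJ⟩

/-- Refutations of the v3 key transfer to the registered v3.1 key (contrapositive of `eft3_of_eft4S`). -/
theorem not_eft4S_of_not_eft3 (p : ℕ) (h : ¬ LocalWeightedDropEFT3 p) : ¬ LocalWeightedDropEFT4S p :=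
  fun h4 => h (eft3_of_eft4S p h4)

end Seam

end Summit.ResolutionOfSingularities.ResolutionOfSingularities.Cruxes.HypersurfaceCentreConstruction.LocalEngine

end
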